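import Literature.Analysis.Calculus.ExpDifferentialAdSeries
import Mathlib.Analysis.CStarAlgebra.Matrix
import HarnessLib

/-!
# Route `UnitScaleTilt`, crux K1 child «MinimiserStabilityRegPr» (stmt-QuantumFields-19200), skeleton v10, stub `stub_existenceMinimalOrbit` (EX), route (α) — **THE VELOCITY MAP
# `g(ad(−A₁))` OF THE CHART POINT PRESERVES `𝔰𝔲(2)`-VALUED FIELDS** (companion of ✓`Prop7ChartVelocityDexp` (T1); ★w2-19200 g4's reminder 2026-08-28 14:04Z: the sets `T`, and the binders `hsplit`∕`hcrit` of
# ★★`Prop7TangentCriticalSplit.tangentCritical_su2_of_split` ∕ ✓`Prop7FibreELOfTangentCriticalSU2`, quantify over `𝔰𝔲(2)`-valued fields, so the transported slice directions `Mα` must be seen to be `𝔰𝔲(2)`-valued).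

Cell `ym3-torus`, width seat `ym-ust-20520-w5` (gen 6).  THEOREMS ONLY (0 `def`, 0 `sorry`).  `--supports stmt-QuantumFields-19200 --as helper`, count-neutral.  YM₃ on T³ is a ladder rung (R3), not
the Clay problem; nothing here claims the stub, the crux, d = 4 or the mass gap.

WHAT IS PROVED (sorry-free, no definition; `g = ExpDifferential.gSer ℂ`, `ad = ExpDifferential.ad ℂ`, [Balaban1985Averaging] (32)–(34)): in any complete normed star-`ℂ`-algebra,
`star_ad_pow_apply_of_skew` (`Y`, `h` skew-Hermitian ⟹ `(ad Y)ⁿh` skew-Hermitian) and ★`star_gSer_ad_apply_of_skew` (`g(ad Y)h` skew-Hermitian: real coefficients `(−1)ⁿ∕(n+1)!`, `tsum_star`); for complex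
matrices `trace_ad_pow_apply` (`tr((ad Y)ⁿh) = 0` when `tr h = 0`; commutators are traceless) and ★`trace_gSer_ad_apply` (`tr(g(ad Y)h) = 0`, trace through the `tsum`).  So for `A₁(b)`, `α(b) ∈ 𝔰𝔲(2)` the
velocity `g(ad(−A₁(b)))(α(b))` of T1 is in `𝔰𝔲(2)`.  HONEST SCOPE: elementary; no estimate; nothing of print asserted.

References: T. Bałaban, CMP 98 (1985) 17–51 [Balaban1985Averaging] ((32)–(34) pp.22–23); B. C. Hall, GTM 222, Thm 5.4.
-/

set_option autoImplicit false

noncomputable section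

open scoped BigOperators Matrix Matrix.Norms.L2Operator Topology Nat
open Filter

namespace Summit.QuantumFields.YangMills.Theorems.Prop7ChartVelocitySU2

open NormedSpace

/-! ## §1 Skew-Hermitian part (any star algebra) -/

section SU2

open Literature.Analysis.Calculus.ExpDifferential (ad ad_apply gSer gSer_ad_apply summable_gSer_term')

variable {𝔸 : Type*} [NormedRing 𝔸] [NormedAlgebra ℂ 𝔸] [CompleteSpace 𝔸] [StarRing 𝔸] [ContinuousStar 𝔸] [StarModule ℂ 𝔸]

omit [CompleteSpace 𝔸] [ContinuousStar 𝔸] [StarModule ℂ 𝔸] in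
/-- `ad Y` preserves skew-Hermitian elements when `Y` is skew-Hermitian: `(Yh − hY)ᴴ = hᴴYᴴ − Yᴴhᴴ = −(Yh − hY)`. [folklore] -/
theorem star_ad_pow_apply_of_skew {Y h : 𝔸} (hY : star Y = -Y) (hh : star h = -h) (n : ℕ) :
    star ((ad ℂ Y ^ n) h) = -((ad ℂ Y ^ n) h) := by
  induction n with
  | zero => simpa using hh
  | succ n ih =>
    rw [pow_succ']
    show star (ad ℂ Y ((ad ℂ Y ^ n) h)) = -(ad ℂ Y ((ad ℂ Y ^ n) h))
    rw [ad_apply, star_sub, star_mul, star_mul, ih, hY]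
    noncomm_ring

/-- ★ **`g(ad Y)` PRESERVES SKEW-HERMITIAN ELEMENTS** (`Y` skew-Hermitian): the coefficients `(−1)ⁿ∕(n+1)!` of `g` are real and every `(ad Y)ⁿh` is skew-Hermitian. [cite: Balaban1985Averaging, (32)-(34) pp.22-23] -/
theorem star_gSer_ad_apply_of_skew {Y h : 𝔸} (hY : star Y = -Y) (hh : star h = -h) :
    star (gSer ℂ (ad ℂ Y) h) = -(gSer ℂ (ad ℂ Y) h) := by
  rw [gSer_ad_apply, tsum_star, ← tsum_neg]
  refine tsum_congr fun n => ?_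
  rw [star_smul, star_ad_pow_apply_of_skew hY hh n, smul_neg]
  congr 1
  rw [Complex.star_def, map_mul, map_pow, map_neg, map_one, map_inv₀, map_natCast]

end SU2

/-! ## §2 Traceless part (matrices) -/

section SU2Matrix

open Literature.Analysis.Calculus.ExpDifferential (ad ad_apply gSer gSer_ad_apply summable_gSer_term')

/-- `ad Y` kills traces: `tr((ad Y)ⁿ⁺¹ h) = 0`, and `tr((ad Y)⁰ h) = tr h`. [folklore] -/
theorem trace_ad_pow_apply {N : ℕ} (Y h : Matrix (Fin N) (Fin N) ℂ) (hh : h.trace = 0) (n : ℕ) :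
    ((ad ℂ Y ^ n) h).trace = 0 := by
  induction n with
  | zero => simpa using hh
  | succ n ih =>
    rw [pow_succ']
    show (ad ℂ Y ((ad ℂ Y ^ n) h)).trace = 0
    rw [ad_apply, Matrix.trace_sub, Matrix.trace_mul_comm, sub_self]

/-- ★ **`g(ad Y)` PRESERVES TRACELESS MATRICES**. [cite: Balaban1985Averaging, (32)-(34) pp.22-23] -/
theorem trace_gSer_ad_apply {N : ℕ} (Y h : Matrix (Fin N) (Fin N) ℂ) (hh : h.trace = 0) :
    (gSer ℂ (ad ℂ Y) h).trace = 0 := by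
  rw [gSer_ad_apply]
  have hs : Summable fun n : ℕ => ((-1) ^ n * ((n + 1)! : ℂ)⁻¹) • (ad ℂ Y ^ n) h := by
    have h1 := (ContinuousLinearMap.apply ℂ (Matrix (Fin N) (Fin N) ℂ) h).summable (summable_gSer_term' (𝕂 := ℂ) (ad ℂ Y))
    refine h1.congr fun n => ?_
    simp only [ContinuousLinearMap.apply_apply, smul_apply]
  set τ : Matrix (Fin N) (Fin N) ℂ →L[ℂ] ℂ := LinearMap.toContinuousLinearMap (Matrix.traceLinearMap (Fin N) ℂ ℂ) with hτ
  have hτapp : ∀ M : Matrix (Fin N) (Fin N) ℂ, τ M = M.trace := fun M => rfl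
  rw [← hτapp, τ.map_tsum hs]
  have h0 : ∀ n : ℕ, τ (((-1) ^ n * ((n + 1)! : ℂ)⁻¹) • (ad ℂ Y ^ n) h) = 0 := fun n => by
    rw [map_smul, hτapp, trace_ad_pow_apply Y h hh n, smul_zero]
  simp only [h0, tsum_zero]

end SU2Matrix


end Summit.QuantumFields.YangMills.Theorems.Prop7ChartVelocitySU2

end
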